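import Mathlib

/-!
# The number of non-squares modulo a prime `q ≡ 3 (mod 4)` is `(q-1)/2 = q/2`

Support file for item stmt-MatrixMultiplication-14308 (route `FourierTwoFamiliesModP`, decl
`PrimeTwoFamilies`, line Sketch, c4 "Paley capacity minus one").

For an odd prime `q` exactly half of the `q - 1` non-zero residues are non-squares
(Ireland–Rosen, *A Classical Introduction to Modern Number Theory* (1982), §5.1, Corollary 1 to
Prop. 5.1.2: "There are as many residues as nonresidues mod p").  The lead file needs the count
of the non-squares of `ZMod q` (the element `0 = 0 * 0` counts as a square) for a prime
`q ≡ 3 (mod 4)` in the form `q / 2` (natural-number division; `q` is odd, so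
`q / 2 = (q - 1) / 2`): it is the number `|K|` of frequencies in the rank certificate for the
Sperner capacity of the Paley tournament.

Proof (quadratic character `χ = quadraticChar (ZMod q)`, values in `ℤ`).  Pointwise,
`2·[s non-square] = 1 - χ s - [s = 0]` (`χ 0 = 0` and `0` is a square, `χ s = 1` on non-zero
squares, `χ s = -1` on non-squares), so summing over `s`,
`2 · count = q - Σ_s χ s - 1 = q - 1` by `quadraticChar_sum_zero` (this is where `q ≠ 2`,
a consequence of `q ≡ 3 (mod 4)`, is used).

No definitions; Mathlib only.
-/

-- the summit path `Summits/MatrixMultiplication/MatrixMultiplication/…` forces the repeated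
-- namespace segment
set_option linter.dupNamespace false

namespace Summit.MatrixMultiplication.MatrixMultiplication.Theorems.PrimeTwoFamilies.PaleyRankBound

/-- **Half of the non-zero residues are non-squares** (Ireland–Rosen 1982, §5.1, Cor. 1 to
Prop. 5.1.2).  For a prime `q ≡ 3 (mod 4)` the number of non-squares of `ZMod q` is
`(q - 1)/2 = q/2` (`0` is a square).  Proof by the quadratic character:
`2·count = Σ_s (1 - χ s - [s = 0]) = q - Σ_s χ s - 1 = q - 1`. -/
theorem paley_card_nonsq {q : ℕ} [Fact q.Prime] (hq3 : q % 4 = 3) :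
    (Finset.univ.filter fun s : ZMod q => ¬ IsSquare s).card = q / 2 := by
  set χ := quadraticChar (ZMod q)
  have hq2 : ringChar (ZMod q) ≠ 2 := by
    rw [ZMod.ringChar_zmod_n]
    omega
  -- pointwise identity `2·[s non-square] = 1 - χ s - [s = 0]`
  have hpt : ∀ s : ZMod q, 2 * (if ¬ IsSquare s then (1 : ℤ) else 0) =
      1 - χ s - (if s = 0 then 1 else 0) := by
    intro s
    by_cases hs0 : s = 0
    · have hP : ¬ ¬ IsSquare s := fun h => h (hs0 ▸ IsSquare.zero)
      rw [if_neg hP, if_pos hs0, hs0, MulChar.map_zero]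
      ring
    by_cases hsq : IsSquare s
    · rw [if_neg (not_not_intro hsq), if_neg hs0, (quadraticChar_one_iff_isSquare hs0).mpr hsq]
      ring
    · rw [if_pos hsq, if_neg hs0, quadraticChar_neg_one_iff_not_isSquare.mpr hsq]
      ring
  -- the cardinality as an integer sum
  have hcard : (((Finset.univ.filter fun s : ZMod q => ¬ IsSquare s).card : ℕ) : ℤ) =
      ∑ s : ZMod q, (if ¬ IsSquare s then (1 : ℤ) else 0) :=
    Finset.natCast_card_filter _ _
  -- evaluate the character sums
  have hone : ∑ _s : ZMod q, (1 : ℤ) = q := by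
    rw [Finset.sum_const, Finset.card_univ, ZMod.card, nsmul_eq_mul, mul_one]
  have hχ0 : ∑ s : ZMod q, χ s = 0 := quadraticChar_sum_zero hq2
  have htot : 2 * ∑ s : ZMod q, (if ¬ IsSquare s then (1 : ℤ) else 0) = (q : ℤ) - 1 := by
    rw [Finset.mul_sum, Finset.sum_congr rfl fun s _ => hpt s, Finset.sum_sub_distrib,
      Finset.sum_sub_distrib, hone, hχ0, Fintype.sum_ite_eq']
    ring
  omega

end Summit.MatrixMultiplication.MatrixMultiplication.Theorems.PrimeTwoFamilies.PaleyRankBound
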